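import Summits.ValiantsHypothesis.ValiantsHypothesis.Theorems.LacunarySymmetroidMatrixDescartesCensusDoorA34NodeChambers

/-!
# `MatrixDescartes` census — the INTERVAL PARITY rule for real polynomials and the parity rule per node-chamber visit

HONEST FRAMING.  Object-search cell `pub-symmetroid`, door-A seat `val-sym-door-p3` (g9); item stmt-ValiantsHypothesis-19980
`DoorA34 = PosRootLawAt 3 4 18` (route item `Theses.LacunarySymmetroid.DoorA34`) is OPEN and asserted nowhere in this file.
A library lemma the node picture needs and the tree did not have, plus its node-frame consequence:

* **`even_countP_roots_Ioo_iff`** — INTERVAL PARITY: for a non-zero real polynomial `f` and `a < b` with `f(a), f(b) ≠ 0`, the number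
  of roots of `f` in `(a,b)` COUNTED WITH MULTIPLICITY is EVEN iff `f(a) f(b) > 0` (induction on the degree: peel one root `r ∈ (a,b)`,
  `f = (X − r) g`, the factor `(a − r)(b − r) < 0` flips the sign; no root ⇒ same sign by the intermediate value theorem).
  `odd_countP_roots_Ioo_iff` is the complement.
* **`det_wall_product_parity`** — PARITY RULE PER CHAMBER VISIT of a node-frame pencil (`…CensusDoorA34NodeChambers`): if
  `t₁ < t₂` are simple walls of the node nomials — `ℓ₃(t₁) = 0` with `ℓ₀ℓ₁ℓ₂(t₁) ≠ 0`, and `ℓⱼ(t₂) = 0` for the wall index `j` at `t₂`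
  with the other three non-zero (stated for `j = 3` and, by relabelling the pencil, for any `j`) — then `det F` does not vanish at
  the walls (`det_ne_zero_of_simpleWall`) and the number of det-roots in `(t₁,t₂)` counted with multiplicity is even iff
  `det F(t₁) · det F(t₂) > 0`, i.e. iff `ℓ₀ℓ₁ℓ₂(t₁) · ℓ₀ℓ₁ℓ₂(t₂) > 0` (`det F(tᵢ) = C₃² ℓ₀ℓ₁ℓ₂(tᵢ)`).  For a nineteen all roots are
  simple, so this is the parity of the number of DISTINCT roots in the visit: ODD iff the visit is monotone (entered from a
  chamber with one fewer / left to one with one more negative node value, or vice versa), EVEN iff it returns.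

Nothing here bounds `ζ_sym(3,4)`; `DoorA34` stays OPEN; nothing bears on `MatrixDescartes` (stmt-ValiantsHypothesis-18050) or on
`VP ≠ VNP`.  [folklore] Intermediate value theorem + root peeling; elementary.
-/

-- `Summit.ValiantsHypothesis.ValiantsHypothesis.…` repeats a component by the D-0017 layout
-- (single-conjunct summit), which the `dupNamespace` linter flags; the name is mandated.
set_option linter.dupNamespace false

namespace Summit.ValiantsHypothesis.ValiantsHypothesis.Theorems.LacunarySymmetroidMatrixDescartes.Census

open Finset Polynomial
open scoped BigOperators Matrix Polynomial
open Summit.ValiantsHypothesis.ValiantsHypothesis.Theorems.SymmetroidDescartes (eval_det_pencil)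

/-! ## Interval parity for real polynomials -/

/-- If a real polynomial takes values of opposite strict signs at `a < b`, it has a root in `(a,b)` (intermediate value theorem). [folklore] -/
theorem exists_root_Ioo_of_mul_neg (f : ℝ[X]) {a b : ℝ} (hab : a < b) (h : f.eval a * f.eval b < 0) :
    ∃ r ∈ Set.Ioo a b, f.IsRoot r := by
  have hcont : ContinuousOn (fun x => f.eval x) (Set.Icc a b) := f.continuous.continuousOn
  rcases lt_or_gt_of_ne (show f.eval a ≠ 0 from fun h0 => by rw [h0, zero_mul] at h; exact lt_irrefl _ h) with ha | ha
  · have hb : 0 < f.eval b := by nlinarith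
    obtain ⟨r, hr, hfr⟩ := intermediate_value_Ioo hab.le hcont ⟨ha, hb⟩
    exact ⟨r, hr, hfr⟩
  · have hb : f.eval b < 0 := by nlinarith
    obtain ⟨r, hr, hfr⟩ := intermediate_value_Ioo' hab.le hcont ⟨hb, ha⟩
    exact ⟨r, hr, hfr⟩

/-- **INTERVAL PARITY.**  For a non-zero real polynomial `f`, `a < b`, `f(a) ≠ 0 ≠ f(b)`: the number of roots of `f` in the open
interval `(a,b)`, counted with multiplicity, is EVEN iff `f(a)·f(b) > 0`. [folklore] -/
theorem even_countP_roots_Ioo_iff :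
    ∀ (n : ℕ) (f : ℝ[X]), f.natDegree ≤ n → f ≠ 0 → ∀ {a b : ℝ}, a < b → f.eval a ≠ 0 → f.eval b ≠ 0 →
      (Even (f.roots.countP (fun r => a < r ∧ r < b)) ↔ 0 < f.eval a * f.eval b) := by
  intro n
  induction n with
  | zero =>
    intro f hdeg hf a b hab ha hb
    -- degree 0: no roots at all
    have hroots : f.roots = 0 := by
      have hC : f = C (f.coeff 0) := Polynomial.eq_C_of_natDegree_le_zero hdeg
      rw [hC, Polynomial.roots_C]
    rw [hroots, Multiset.countP_zero]
    refine ⟨fun _ => ?_, fun _ => ⟨0, rfl⟩⟩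
    have hC : f = C (f.coeff 0) := Polynomial.eq_C_of_natDegree_le_zero hdeg
    have hea : f.eval a = f.coeff 0 := by rw [hC]; simp
    have heb : f.eval b = f.coeff 0 := by rw [hC]; simp
    rw [hea, heb]
    rw [hea] at ha
    exact mul_self_pos.mpr ha
  | succ n ih =>
    intro f hdeg hf a b hab ha hb
    by_cases hroot : ∃ r ∈ Set.Ioo a b, f.IsRoot r
    · -- peel one root
      obtain ⟨r, ⟨har, hrb⟩, hfr⟩ := hroot
      set g := f /ₘ (X - C r) with hg
      have hfg : (X - C r) * g = f := mul_divByMonic_eq_iff_isRoot.mpr hfr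
      have hg0 : g ≠ 0 := by
        intro h0; rw [h0, mul_zero] at hfg; exact hf hfg.symm
      have hXr : (X - C r : ℝ[X]) ≠ 0 := X_sub_C_ne_zero r
      have hdegg : g.natDegree ≤ n := by
        have h := congr_arg Polynomial.natDegree hfg
        rw [Polynomial.natDegree_mul hXr hg0, natDegree_X_sub_C] at h
        omega
      have hga : g.eval a ≠ 0 := by
        intro h0; apply ha; rw [← hfg, eval_mul, h0, mul_zero]
      have hgb : g.eval b ≠ 0 := by
        intro h0; apply hb; rw [← hfg, eval_mul, h0, mul_zero]
      have hih := ih g hdegg hg0 hab hga hgb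
      -- roots and values of f through g
      have hroots : f.roots.countP (fun r => a < r ∧ r < b) = g.roots.countP (fun r => a < r ∧ r < b) + 1 := by
        rw [← hfg, roots_mul (by rw [hfg]; exact hf), roots_X_sub_C, Multiset.countP_add,
          ← Multiset.cons_zero r, Multiset.countP_cons_of_pos _ ⟨har, hrb⟩, Multiset.countP_zero]
        ring
      have hval : f.eval a * f.eval b = ((a - r) * (b - r)) * (g.eval a * g.eval b) := by
        rw [← hfg, eval_mul, eval_mul]; simp; ring
      have hneg : (a - r) * (b - r) < 0 := mul_neg_of_neg_of_pos (by linarith) (by linarith)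
      rw [hroots, hval, Nat.even_add_one, hih]
      constructor
      · intro hng
        have hgg : g.eval a * g.eval b < 0 := lt_of_le_of_ne (not_lt.mp hng) (mul_ne_zero hga hgb)
        exact mul_pos_of_neg_of_neg hneg hgg
      · intro hpos hgpos
        have := mul_neg_of_neg_of_pos hneg hgpos
        linarith
    · -- no root in (a,b): count zero, same sign
      push Not at hroot
      have hzero : f.roots.countP (fun r => a < r ∧ r < b) = 0 := by
        rw [Multiset.countP_eq_zero]
        intro r hr ⟨har, hrb⟩
        exact hroot r ⟨har, hrb⟩ ((mem_roots hf).mp hr)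
      rw [hzero]
      refine ⟨fun _ => ?_, fun _ => ⟨0, rfl⟩⟩
      rcases lt_or_gt_of_ne (mul_ne_zero ha hb) with hlt | hgt
      · obtain ⟨r, hr, hfr⟩ := exists_root_Ioo_of_mul_neg f hab hlt
        exact absurd hfr (hroot r hr)
      · exact hgt

/-- **INTERVAL PARITY (packaged).** [folklore] -/
theorem even_countP_roots_Ioo_iff' (f : ℝ[X]) (hf : f ≠ 0) {a b : ℝ} (hab : a < b) (ha : f.eval a ≠ 0)
    (hb : f.eval b ≠ 0) : Even (f.roots.countP (fun r => a < r ∧ r < b)) ↔ 0 < f.eval a * f.eval b :=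
  even_countP_roots_Ioo_iff f.natDegree f le_rfl hf hab ha hb

/-- … and the ODD case: an odd number of roots (with multiplicity) in `(a,b)` iff `f(a)·f(b) < 0`. [folklore] -/
theorem odd_countP_roots_Ioo_iff (f : ℝ[X]) (hf : f ≠ 0) {a b : ℝ} (hab : a < b) (ha : f.eval a ≠ 0)
    (hb : f.eval b ≠ 0) : Odd (f.roots.countP (fun r => a < r ∧ r < b)) ↔ f.eval a * f.eval b < 0 := by
  rw [← Nat.not_even_iff_odd, even_countP_roots_Ioo_iff' f hf hab ha hb, not_lt]
  exact ⟨fun h => lt_of_le_of_ne h (mul_ne_zero ha hb), fun h => h.le⟩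

/-! ## Parity rule per chamber visit of a node-frame pencil -/

/-- **Parity between two simple walls of the node nomial `ℓ₃`** (the general wall pair follows by relabelling the nodes of the
pencil).  Let `S l = ∑ᵢ A i l • vᵢvᵢᵀ`, `v₀,v₁,v₂` independent, and let `t₁ < t₂` be zeros of the node nomial `ℓ₃` at which
`ℓ₀, ℓ₁, ℓ₂` do not vanish.  Then `det F` does not vanish at `t₁, t₂`, and the number of det-roots in `(t₁, t₂)` counted with
multiplicity is EVEN iff `ℓ₀ℓ₁ℓ₂(t₁) · ℓ₀ℓ₁ℓ₂(t₂) > 0`. [folklore] -/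
theorem det_wall_product_parity {K : ℕ} (d : Fin K → ℕ) (A : Fin 4 → Fin K → ℝ) (v : Fin 4 → Fin 3 → ℝ)
    (hC : (Matrix.of ![v 0, v 1, v 2]).det ≠ 0) {t₁ t₂ : ℝ} (ht : t₁ < t₂)
    (h3a : ∑ l, A 3 l * t₁ ^ d l = 0) (h0a : ∑ l, A 0 l * t₁ ^ d l ≠ 0) (h1a : ∑ l, A 1 l * t₁ ^ d l ≠ 0)
    (h2a : ∑ l, A 2 l * t₁ ^ d l ≠ 0)
    (h3b : ∑ l, A 3 l * t₂ ^ d l = 0) (h0b : ∑ l, A 0 l * t₂ ^ d l ≠ 0) (h1b : ∑ l, A 1 l * t₂ ^ d l ≠ 0)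
    (h2b : ∑ l, A 2 l * t₂ ^ d l ≠ 0)
    (hP : (∑ l, (X : ℝ[X]) ^ d l • (∑ i, A i l • Matrix.vecMulVec (v i) (v i)).map C).det ≠ 0) :
    Even ((∑ l, (X : ℝ[X]) ^ d l • (∑ i, A i l • Matrix.vecMulVec (v i) (v i)).map C).det.roots.countP
        (fun r => t₁ < r ∧ r < t₂)) ↔
      0 < ((∑ l, A 0 l * t₁ ^ d l) * (∑ l, A 1 l * t₁ ^ d l) * (∑ l, A 2 l * t₁ ^ d l)) *
          ((∑ l, A 0 l * t₂ ^ d l) * (∑ l, A 1 l * t₂ ^ d l) * (∑ l, A 2 l * t₂ ^ d l)) := by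
  have hev : ∀ t : ℝ, ((∑ l, (X : ℝ[X]) ^ d l • (∑ i, A i l • Matrix.vecMulVec (v i) (v i)).map C).det).eval t
      = (∑ i, (∑ l, A i l * t ^ d l) • Matrix.vecMulVec (v i) (v i)).det := fun t =>
    eval_det_pencil_rankOneLetters d A v t
  have hw1 : ((∑ l, (X : ℝ[X]) ^ d l • (∑ i, A i l • Matrix.vecMulVec (v i) (v i)).map C).det).eval t₁
      = (Matrix.of ![v 0, v 1, v 2]).det ^ 2 *
          ((∑ l, A 0 l * t₁ ^ d l) * (∑ l, A 1 l * t₁ ^ d l) * (∑ l, A 2 l * t₁ ^ d l)) := by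
    rw [hev]; exact det_eq_of_node_three_zero v (fun i => ∑ l, A i l * t₁ ^ d l) h3a
  have hw2 : ((∑ l, (X : ℝ[X]) ^ d l • (∑ i, A i l • Matrix.vecMulVec (v i) (v i)).map C).det).eval t₂
      = (Matrix.of ![v 0, v 1, v 2]).det ^ 2 *
          ((∑ l, A 0 l * t₂ ^ d l) * (∑ l, A 1 l * t₂ ^ d l) * (∑ l, A 2 l * t₂ ^ d l)) := by
    rw [hev]; exact det_eq_of_node_three_zero v (fun i => ∑ l, A i l * t₂ ^ d l) h3b
  have hne1 : ((∑ l, (X : ℝ[X]) ^ d l • (∑ i, A i l • Matrix.vecMulVec (v i) (v i)).map C).det).eval t₁ ≠ 0 := by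
    rw [hw1]; exact mul_ne_zero (pow_ne_zero 2 hC) (mul_ne_zero (mul_ne_zero h0a h1a) h2a)
  have hne2 : ((∑ l, (X : ℝ[X]) ^ d l • (∑ i, A i l • Matrix.vecMulVec (v i) (v i)).map C).det).eval t₂ ≠ 0 := by
    rw [hw2]; exact mul_ne_zero (pow_ne_zero 2 hC) (mul_ne_zero (mul_ne_zero h0b h1b) h2b)
  rw [even_countP_roots_Ioo_iff' _ hP ht hne1 hne2, hw1, hw2]
  have hC2 : 0 < ((Matrix.of ![v 0, v 1, v 2]).det ^ 2) ^ 2 := by positivity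
  have key : (Matrix.of ![v 0, v 1, v 2]).det ^ 2 *
          ((∑ l, A 0 l * t₁ ^ d l) * (∑ l, A 1 l * t₁ ^ d l) * (∑ l, A 2 l * t₁ ^ d l)) *
        ((Matrix.of ![v 0, v 1, v 2]).det ^ 2 *
          ((∑ l, A 0 l * t₂ ^ d l) * (∑ l, A 1 l * t₂ ^ d l) * (∑ l, A 2 l * t₂ ^ d l)))
      = ((Matrix.of ![v 0, v 1, v 2]).det ^ 2) ^ 2 *
        (((∑ l, A 0 l * t₁ ^ d l) * (∑ l, A 1 l * t₁ ^ d l) * (∑ l, A 2 l * t₁ ^ d l)) *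
          ((∑ l, A 0 l * t₂ ^ d l) * (∑ l, A 1 l * t₂ ^ d l) * (∑ l, A 2 l * t₂ ^ d l))) := by ring
  rw [key, mul_pos_iff_of_pos_left hC2]

end Summit.ValiantsHypothesis.ValiantsHypothesis.Theorems.LacunarySymmetroidMatrixDescartes.Census
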